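import Literature.Probability.LatticeModels.TreeGraphWickTuples
import Literature.Probability.LatticeModels.TreeGraphWickPairInteraction
import Literature.Probability.LatticeModels.HighDimTrivialityUrsellSum
import Literature.Probability.LatticeModels.HighDimTrivialityProofs
import HarnessLib

/-!
# High-dimensional triviality of Ising scaling limits, VI: proof of Panis's Theorem 5.5 (`d ≥ 5`)

Topic `Literature/Probability/LatticeModels`; family `crit-ising` (crit-ising.S13). Second proof
companion of `HighDimTriviality` (next to `HighDimTrivialityProofs`, which reduces the fact below to the
unproved source form of Aizenman's Prop. 12.1, `aizenman_wickDeviation_le_finite`): this file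
**discharges**, unconditionally, the named fact

* `panis_mgf_normalizedField_bound` — R. Panis, *Triviality of the scaling limits of critical Ising and
  `φ⁴` models with effective dimension at least four*, Ann. Probab. 54 (2026) = arXiv:2309.05797,
  **Theorem 5.5** for the nearest-neighbour ferromagnetic Ising model on `ℤ^d`, `d ≥ 5`: there are
  `C, γ > 0` such that for all `0 < β ≤ β_c`, `L ≥ 1`, `f ∈ C_0(ℝ^d)` vanishing outside `[-r,r]^d`
  (`r ≥ 1`), the DLR state `μ ∈ 𝒢(β,0)` and `z ∈ ℝ`,
  `|⟨exp(z T_{f,L})⟩ - exp(z²/2 ⟨T_{f,L}²⟩)| ≤ exp(z²/2 ⟨T_{|f|,L}²⟩) · C (β⁻⁴ ∨ β⁻²) ‖f‖_∞⁴ r^γ z⁴ / L^{d-4}`.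

## The proof (Panis 2023, proof of Thm 5.5, pp. 21–22, with the tree diagram bound moved INSIDE
## Aizenman's inequality)

The printed proof combines (i) the deviation of the `2n`-point function from Wick's law,
Prop. 4.6 (Aizenman 1982, Prop. 12.1: `|S_{2n} - 𝒢_n| ≤ (3/2) ∑_{s} |U₄(x_s)| 𝒢_{n-2}(x_{s̸})`), (ii) the
tree diagram bound `|U₄| ≤ 2 ∑_u ∏⟨σ_{xᵢ}σ_u⟩`, (iii) the summation over `n`, and (iv) the estimate of
`S(β,L,f) = Σ_L⁻² ∑ |U₄|` by infrared bounds. The tree proves (i) directly in the TREE FORM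
`|S_{2n} - 𝒢_n| ≤ c ∑_s T(x_s) 𝒢_{n-2}(x_{s̸})`, `T(u) = ∑_v ∏_j ⟨σ_{u_j}σ_v⟩` (random currents:
`TreeGraphWickCurrents` / `TreeGraphWickBound` / `TreeGraphWickPairing`; coincident points:
`TreeGraphWickTuples`, constant `c = 8`, in every finite volume `Λ_M` with free boundary condition,
`abs_nPoint_sub_pairingSum_le_box`), which is (i)+(ii) at once, so the four-point Ursell function never
appears. The steps here:

1. `sum_abs_boxTree_le` — in the free box `Λ_M`, the smeared tree diagram is dominated by the
   infinite-volume free two-point function `S = ⟨σ₀σ_·⟩^∅_β` (Griffiths II in the volume):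
   `∑_{u ∈ Λ⁴} T_M(u) ≤ ∑_{v ∈ Λ_M} (∑_{a ∈ Λ} S(a - v))⁴`, bounded uniformly in `M` by
   `C r^{4d} L^{4-d} (|Λ_{m₀}|χ_{m₀})²` (`two_mul_sum_shiftSum_pow_four_le` of `HighDimTrivialityUrsellSum`:
   Messager–Miracle-Solé, the infrared bound at `β_c` and Griffiths' monotonicity in `β`);
2. the smeared moment bound in the volume `Λ_M` (`abs_integral_normalizedField_pow_sub_le_of_remainderBoundOn`
   of `TreeGraphWickPairInteraction`, the generalisation of `AizenmanWickBoundLocal` to an arbitrary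
   four-point weight): `|⟨T^{2n}⟩_M - (2n-1)!!⟨T²⟩_Mⁿ| ≤ 8 (2n)⁴ ‖f‖_∞⁴ (C r^{4d}L^{4-d}(|Λ_{m₀}|χ_{m₀})²/Σ_L(M)²)
   (2n-5)!! ⟨T_{|f|}²⟩_M^{n-2}`;
3. `M → ∞` (`tendsto_integral_normalizedField_pow_box`: the moments of the smeared field in `Λ_M` converge
   to those of the DLR state, which for `β ≤ β_c` is the translation-invariant free state,
   `isingGibbsMeasure_eq_freeState`), and `|Λ_{m₀}|χ_{m₀} ≤ Σ_L` (`card_mul_sum_box_le_blockSpinVariance`):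
   `abs_moment_sub_wick_le_of_le_criticalBeta`;
4. the summation over `n` (`abs_mgf_sub_exp_le_of_wickMoment_bounds` of `AizenmanWickBound`, pure
   probability) with the vanishing of odd moments (`oddSpinCorrelation_eq_zero_holds` of
   `HighDimTrivialityProofs`), and `1 ≤ (β_c² + 1)(β⁻⁴ ∨ β⁻²)` for `0 < β ≤ β_c` to match the printed
   `β`-dependence: `panis_mgf_normalizedField_bound_holds` with `γ = 4d`.

## References

* R. Panis, arXiv:2309.05797, Thm 5.5 and its proof, pp. 21–22; Prop. 4.6 [Panis2023Triviality] (held; read).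
* M. Aizenman, Comm. Math. Phys. 86 (1982), Prop. 5.3, Prop. 12.1 [AizenmanCMP1982]; M. Aizenman, CDM 2020,
  §7–§8 [AizenmanCDM2020]; M. Aizenman, H. Duminil-Copin, Ann. of Math. 194 (2021), §6.3
  [AizenmanDuminilCopinAnnals2021].

## Design

No definition and no named fact is introduced; every input is a theorem of the tree.
-/

noncomputable section

open MeasureTheory Filter Finset
open scoped Topology Nat
open Literature.Probability.LatticeModels Literature.Probability.Percolation
open Literature.Barriers.CriticalPhenomena

namespace Literature.Probability.LatticeModels

variable {d : ℕ}

/-! ### Step 1. The smeared tree diagram in a free box -/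

/-- **The smeared tree diagram of a free box is dominated by the infinite-volume free two-point
function** (Griffiths' second inequality in the volume, `⟨σ_aσ_v⟩^∅_{Λ_M} ≤ ⟨σ₀σ_{a-v}⟩^∅_β`, and the
exchange `∑_{u∈Λ⁴} ∑_v ∏_j S(u_j-v) = ∑_v (∑_{a∈Λ} S(a-v))⁴`; Panis 2023, proof of Thm 5.5, the display
"Applying the tree diagram bound … S(β,L,f) ≤ 2 ∑_x ∑_{x₁,…,x₄} ∏⟨σ_xσ_{xᵢ}⟩/Σ_L²"): for `β ≥ 0` and
`Λ ⊆ Λ_M`,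
`∑_{u ∈ Λ⁴} |∑_{v ∈ Λ_M} ∏_j ⟨σ_{u_j}σ_v⟩^∅_{Λ_M}| ≤ ∑_{v ∈ Λ_M} (∑_{a ∈ Λ} ⟨σ₀σ_{a-v}⟩^∅_β)⁴`.
[cite: Panis2023Triviality, proof of Thm. 5.5, tree diagram bound display (p. 21)] -/
theorem sum_abs_boxTree_le {β : ℝ} (hβ : 0 ≤ β) {Λ : Finset (Site d)} {M : ℕ} (hΛ : Λ ⊆ box d M) :
    ∑ u ∈ Fintype.piFinset (fun _ : Fin 4 => Λ),
        |∑ v ∈ box d M, ∏ j, twoPoint (isingMeasure (zdGraph d) (box d M) β 0 .free) spinAt (u j) v| ≤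
      ∑ v ∈ box d M, (∑ a ∈ Λ, twoPointFree d β (a - v)) ^ 4 := by
  classical
  have hgks : ∀ {Λ A : Finset (Site d)} {β h : ℝ} {bc : BoundaryCondition (Site d)},
      gks_one (zdGraph d) (Λ := Λ) (A := A) (β := β) (h := h) (bc := bc) :=
    GKSInequalities.gks_one_holds (zdGraph d)
  have hlim : hasBoxLimit_isingCorr_free d := hasBoxLimit_isingCorr_free_holds
  have hmono : isingCorr_free_mono_volume (d := d) := isingCorr_free_mono_volume_holds
  have htr : isingTwoPoint_free_translate (d := d) := isingTwoPoint_free_translate_holds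
  set μM := isingMeasure (zdGraph d) (box d M) β 0 .free with hμM
  have h2 : ∀ {a v : Site d}, a ∈ box d M → v ∈ box d M →
      0 ≤ twoPoint μM spinAt a v ∧ twoPoint μM spinAt a v ≤ twoPointFree d β (a - v) := by
    intro a v ha hv
    rw [twoPoint_comm μM spinAt a v]
    change 0 ≤ isingTwoPoint (zdGraph d) (box d M) β 0 .free v a ∧
      isingTwoPoint (zdGraph d) (box d M) β 0 .free v a ≤ twoPointFree d β (a - v)
    exact ⟨isingTwoPoint_free_nonneg hgks hβ hv ha,
      isingTwoPoint_free_le_twoPointFree_sub hmono hlim htr hβ hv ha⟩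
  calc ∑ u ∈ Fintype.piFinset (fun _ : Fin 4 => Λ), |∑ v ∈ box d M, ∏ j, twoPoint μM spinAt (u j) v|
      ≤ ∑ u ∈ Fintype.piFinset (fun _ : Fin 4 => Λ), ∑ v ∈ box d M, ∏ j, twoPointFree d β (u j - v) := by
        refine Finset.sum_le_sum fun u hu => ?_
        have huM : ∀ j, u j ∈ box d M := fun j => hΛ (Fintype.mem_piFinset.1 hu j)
        rw [abs_of_nonneg (Finset.sum_nonneg fun v hv => Finset.prod_nonneg fun j _ => (h2 (huM j) hv).1)]
        exact Finset.sum_le_sum fun v hv => Finset.prod_le_prod (fun j _ => (h2 (huM j) hv).1)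
          fun j _ => (h2 (huM j) hv).2
    _ = ∑ v ∈ box d M, ∑ u ∈ Fintype.piFinset (fun _ : Fin 4 => Λ), ∏ j, twoPointFree d β (u j - v) :=
        Finset.sum_comm
    _ = ∑ v ∈ box d M, (∑ a ∈ Λ, twoPointFree d β (a - v)) ^ 4 := by
        refine Finset.sum_congr rfl fun v _ => ?_
        rw [← Fin.prod_const 4 (∑ a ∈ Λ, twoPointFree d β (a - v)), Finset.prod_univ_sum]

/-! ### Step 3 (preparation). Moments of the smeared field along the free boxes -/

/-- The block-spin second moments of the free boxes converge to that of the state with the free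
correlations (`tendsto_twoPoint_box_free`). [cite: FriedliVelenik2017, Exercise 3.16] -/
theorem tendsto_blockSpinVariance_box {β : ℝ} (hβ : 0 ≤ β) {μ : Measure (SpinConfig (Site d))}
    [IsFiniteMeasure μ] (hcorr : ∀ A : Finset (Site d), spinCorr μ A = freeCorr d β 0 A) (L : ℝ) :
    Tendsto (fun M : ℕ => blockSpinVariance (isingMeasure (zdGraph d) (box d M) β 0 .free) L) atTop
      (𝓝 (blockSpinVariance μ L)) := by
  simp_rw [blockSpinVariance_eq_sum_sum]
  exact tendsto_finsetSum _ fun x _ => tendsto_finsetSum _ fun y _ => tendsto_twoPoint_box_free hβ hcorr x y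

/-- **Thermodynamic limit of the moments of the smeared field**: if the correlations of the probability
measure `μ` are the free box limits and `Σ_L(μ) > 0`, then for every `k`,
`⟨T_{F,L}^k⟩_{Λ_M} → ⟨T_{F,L}^k⟩_μ` as `M → ∞` (the moments are finite sums of correlation functions
times `Σ_L^{-k/2}`, `integral_normalizedField_pow`). [cite: FriedliVelenik2017, Exercise 3.16] -/
theorem tendsto_integral_normalizedField_pow_box {β : ℝ} (hβ : 0 ≤ β)
    {μ : Measure (SpinConfig (Site d))} [IsProbabilityMeasure μ]
    (hcorr : ∀ A : Finset (Site d), spinCorr μ A = freeCorr d β 0 A) {L : ℝ}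
    (hSig : 0 < blockSpinVariance μ L) {F : EuclideanSpace ℝ (Fin d) → ℝ} {r : ℝ} (hL : L ≠ 0)
    (hF : ∀ x, F x ≠ 0 → ∀ i, |x i| ≤ r) (k : ℕ) :
    Tendsto (fun M : ℕ => ∫ σ, normalizedField (isingMeasure (zdGraph d) (box d M) β 0 .free) L F σ ^ k
        ∂(isingMeasure (zdGraph d) (box d M) β 0 .free)) atTop
      (𝓝 (∫ σ, normalizedField μ L F σ ^ k ∂μ)) := by
  simp_rw [integral_normalizedField_pow _ hL hF k]
  refine Tendsto.mul ?_ (tendsto_finsetSum _ fun p _ => Tendsto.const_mul _ ?_)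
  · exact ((((Real.continuous_sqrt.tendsto _).comp (tendsto_blockSpinVariance_box hβ hcorr L)).inv₀
      (Real.sqrt_pos.2 hSig).ne')).pow k
  · exact tendsto_nPoint_box_free hβ hcorr p

/-! ### Steps 2–3. The moment bound for the DLR states, `d ≥ 5`, `β ≤ β_c` -/

/-- **Deviation of the even moments of the smeared field from Wick's law, `d ≥ 5`, all `β ≤ β_c`**
(Panis 2023, proof of Thm 5.5, first display combined with the bounds on (1)–(2): for the
nearest-neighbour model `|⟨T_{f,L}^{2n}⟩ - (2n)!/(2ⁿn!)⟨T_{f,L}²⟩ⁿ| ≤ C' n⁴ ‖f‖_∞⁴ r^γ L^{4-d} (2n-5)!!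
⟨T_{|f|,L}²⟩^{n-2}`, here with the Gaussian `(2n-4)`-th moment in place of `⟨T_{|f|}^{2n-4}⟩`, which is
what the tree form of Prop. 4.6 yields and what the summation uses). For `d ≥ 5` there is `C > 0` with:
for all `0 ≤ β ≤ β_c`, `μ ∈ 𝒢(β,0)`, real `L, r ≥ 1`, `f` continuous vanishing off `[-r,r]^d`, `n ≥ 2`,
`|⟨T_{f,L}^{2n}⟩_μ - (2n)!/(2ⁿn!) ⟨T_{f,L}²⟩_μⁿ| ≤ (2n)⁴ (8 ‖f‖_∞⁴ C r^{4d}/L^{d-4}) (2n-4)!/(2^{n-2}(n-2)!) ⟨T_{|f|,L}²⟩_μ^{n-2}`.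
Proof: the tree-form Wick bound with coincident points in the free boxes `Λ_M`
(`abs_nPoint_sub_pairingSum_le_box`), smeared (`abs_integral_normalizedField_pow_sub_le_of_remainderBoundOn`),
the uniform bound on the smeared tree diagram (`sum_abs_boxTree_le`, `two_mul_sum_shiftSum_pow_four_le`),
the thermodynamic limit of the moments and `|Λ_{m₀}|χ_{m₀} ≤ Σ_L`. [cite: Panis2023Triviality, proof of Thm. 5.5, first display and bounds on (1)–(2) (pp. 21–22)] [cite: AizenmanCMP1982, Prop. 12.1 and Prop. 5.3] -/
theorem abs_moment_sub_wick_le_of_le_criticalBeta (hd : 5 ≤ d) :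
    ∃ C : ℝ, 0 < C ∧ ∀ (β : ℝ), 0 ≤ β → β ≤ criticalBeta d → ∀ μ ∈ isingGibbsMeasures d β 0,
      ∀ (L r : ℝ), 1 ≤ L → 1 ≤ r →
      ∀ f : EuclideanSpace ℝ (Fin d) → ℝ, Continuous f → (∀ x, f x ≠ 0 → ∀ i, |x i| ≤ r) →
      ∀ n : ℕ, 2 ≤ n →
        |(∫ σ, normalizedField μ L f σ ^ (2 * n) ∂μ) -
            ((2 * n)! : ℝ) / (2 ^ n * n !) * (∫ σ, normalizedField μ L f σ ^ 2 ∂μ) ^ n| ≤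
          (2 * n : ℝ) ^ 4 * (8 * (⨆ x, |f x|) ^ 4 * (C * r ^ (4 * d) / L ^ (d - 4))) *
            (((2 * (n - 2))! : ℝ) / (2 ^ (n - 2) * (n - 2)!) *
              (∫ σ, normalizedField μ L (fun x => |f x|) σ ^ 2 ∂μ) ^ (n - 2)) := by
  classical
  have hd3 : 3 ≤ d := by omega
  obtain ⟨C₀, hC₀, hhyp⟩ := twoPointFree_hypotheses (d := d) hd3
  obtain ⟨C, hC, hcore⟩ := two_mul_sum_shiftSum_pow_four_le hd hC₀
  refine ⟨C, hC, fun β hβ hβc μ hμ L r hL hr f hf hfr n hn => ?_⟩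
  obtain ⟨hP, hTI, hcorr⟩ := isingGibbsMeasure_eq_freeState hd3 hβ hβc hμ
  haveI : IsProbabilityMeasure μ := hP
  obtain ⟨hS0, hS00, hMMS, hIR⟩ := hhyp β hβ hβc
  have hL0 : 0 ≤ L := by linarith
  have hLpos : 0 < L := by linarith
  have hLne : L ≠ 0 := hLpos.ne'
  have hr0 : 0 ≤ r := by linarith
  have hfar : ∀ x, (fun y => |f y|) x ≠ 0 → ∀ i, |x i| ≤ r := fun x hx =>
    hfr x (abs_ne_zero.mp hx)
  have h2m₀ : 2 * (⌊L⌋₊ / (2 * d)) ≤ ⌊L⌋₊ := by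
    calc 2 * (⌊L⌋₊ / (2 * d)) ≤ 2 * (d * (⌊L⌋₊ / (2 * d))) :=
          Nat.mul_le_mul_left 2 (Nat.le_mul_of_pos_left _ (by omega))
      _ = 2 * d * (⌊L⌋₊ / (2 * d)) := by ring
      _ ≤ ⌊L⌋₊ := Nat.mul_div_le ⌊L⌋₊ (2 * d)
  have hboxL : latticeBox d L = box d ⌊L⌋₊ := latticeBox_eq_box hL0
  have hboxR : latticeBox d (r * L) = box d ⌊r * L⌋₊ := latticeBox_eq_box (by positivity)
  -- the denominator `|Λ_{m₀}| χ_{m₀} ≤ Σ_L`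
  have hS : ∀ a b, ∫ σ, spinAt a σ * spinAt b σ ∂μ = twoPointFree d β (b - a) :=
    integral_spinAt_mul_spinAt_eq_twoPointFree hTI hcorr
  obtain ⟨D, hD⟩ : ∃ D : ℝ, D = (#(box d (⌊L⌋₊ / (2 * d))) : ℝ) *
      ∑ v ∈ box d (⌊L⌋₊ / (2 * d)), twoPointFree d β v := ⟨_, rfl⟩
  have hden : D ≤ blockSpinVariance μ L := by
    rw [hD]
    exact card_mul_sum_box_le_blockSpinVariance μ hS hS0 hboxL h2m₀
  have hD0 : 0 < D := by
    have hcm₀pos : (0 : ℝ) < #(box d (⌊L⌋₊ / (2 * d))) := by rw [card_box]; positivity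
    have h1 : (1 : ℝ) ≤ ∑ v ∈ box d (⌊L⌋₊ / (2 * d)), twoPointFree d β v :=
      one_le_sum_box hS0 hS00 _
    rw [hD]
    exact mul_pos hcm₀pos (by linarith)
  have hSigpos : 0 < blockSpinVariance μ L := hD0.trans_le hden
  -- notation for the constants
  set Cr : ℝ := C * r ^ (4 * d) / L ^ (d - 4) with hCr
  have hCr0 : 0 ≤ Cr := by positivity
  set Mf : ℝ := ⨆ x, |f x| with hMf
  have hMf0 : 0 ≤ Mf := iSup_abs_nonneg f
  set γ : ℝ := ((2 * (n - 2))! : ℝ) / (2 ^ (n - 2) * (n - 2)!) with hγ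
  have hγ0 : 0 ≤ γ := by positivity
  -- Step 1: the smeared tree diagram of the free boxes, uniformly in `M ≥ ⌊rL⌋`
  have hU : ∀ M : ℕ, ⌊r * L⌋₊ ≤ M →
      ∑ u ∈ Fintype.piFinset (fun _ : Fin 4 => latticeBox d (r * L)),
        |∑ v ∈ box d M, ∏ j, twoPoint (isingMeasure (zdGraph d) (box d M) β 0 .free) spinAt (u j) v| ≤
          Cr * D ^ 2 := by
    intro M hM
    rw [hboxR]
    have h0 : 0 ≤ ∑ v ∈ box d M, (∑ a ∈ box d ⌊r * L⌋₊, twoPointFree d β (a - v)) ^ 4 :=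
      Finset.sum_nonneg fun v _ => pow_nonneg (Finset.sum_nonneg fun a _ => hS0 _) 4
    calc _ ≤ ∑ v ∈ box d M, (∑ a ∈ box d ⌊r * L⌋₊, twoPointFree d β (a - v)) ^ 4 :=
          sum_abs_boxTree_le hβ (box_mono d hM)
      _ ≤ 2 * ∑ v ∈ box d M, (∑ a ∈ box d ⌊r * L⌋₊, twoPointFree d β (a - v)) ^ 4 := by linarith
      _ ≤ Cr * D ^ 2 := by
          rw [hCr, hD]
          exact hcore _ hS0 hS00 hMMS hIR L r hL hr M
  -- Step 2: the moment bound in the volume `Λ_M`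
  have hfin : ∀ M : ℕ, ⌊r * L⌋₊ ≤ M →
      |(∫ σ, normalizedField (isingMeasure (zdGraph d) (box d M) β 0 .free) L f σ ^ (2 * n)
            ∂(isingMeasure (zdGraph d) (box d M) β 0 .free)) -
          ((2 * n)! : ℝ) / (2 ^ n * n !) *
            (∫ σ, normalizedField (isingMeasure (zdGraph d) (box d M) β 0 .free) L f σ ^ 2
              ∂(isingMeasure (zdGraph d) (box d M) β 0 .free)) ^ n| ≤
        8 * (2 * n : ℝ) ^ 4 * Mf ^ 4 *
          (Cr * D ^ 2 / blockSpinVariance (isingMeasure (zdGraph d) (box d M) β 0 .free) L ^ 2) *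
          (γ * (∫ σ, normalizedField (isingMeasure (zdGraph d) (box d M) β 0 .free) L (fun x => |f x|) σ ^ 2
            ∂(isingMeasure (zdGraph d) (box d M) β 0 .free)) ^ (n - 2)) := by
    intro M hM
    have hsub : latticeBox d (r * L) ⊆ box d M := hboxR ▸ box_mono d hM
    have hW : ∀ n' : ℕ, 2 ≤ n' → ∀ x : Fin (2 * n') → Site d, (∀ i, x i ∈ latticeBox d (r * L)) →
        |nPoint (isingMeasure (zdGraph d) (box d M) β 0 .free) spinAt x -
            pairingSum (twoPoint (isingMeasure (zdGraph d) (box d M) β 0 .free) spinAt) n' x| ≤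
          8 * wickRemainder (twoPoint (isingMeasure (zdGraph d) (box d M) β 0 .free) spinAt)
            (fun u => ∑ v ∈ box d M,
              ∏ j, twoPoint (isingMeasure (zdGraph d) (box d M) β 0 .free) spinAt (u j) v) n' x :=
      fun n' _ x hx => abs_nPoint_sub_pairingSum_le_box (box d M) hβ x fun i => hsub (hx i)
    have key := abs_integral_normalizedField_pow_sub_le_of_remainderBoundOn
      (μ := isingMeasure (zdGraph d) (box d M) β 0 .free) hLpos (by norm_num : (0 : ℝ) ≤ 8)
      (fun u => ∑ v ∈ box d M, ∏ j, twoPoint (isingMeasure (zdGraph d) (box d M) β 0 .free) spinAt (u j) v)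
      hW hf hfr hn
    refine key.trans ?_
    have hm0 : 0 ≤ γ * (∫ σ, normalizedField (isingMeasure (zdGraph d) (box d M) β 0 .free) L
        (fun x => |f x|) σ ^ 2 ∂(isingMeasure (zdGraph d) (box d M) β 0 .free)) ^ (n - 2) :=
      mul_nonneg hγ0 (pow_nonneg (integral_nonneg fun σ => sq_nonneg _) _)
    refine mul_le_mul_of_nonneg_right (mul_le_mul_of_nonneg_left
      (div_le_div_of_nonneg_right (hU M hM) (sq_nonneg _)) (by positivity)) hm0
  -- Step 3: the thermodynamic limit
  have hm := fun {F : EuclideanSpace ℝ (Fin d) → ℝ} (hF : ∀ x, F x ≠ 0 → ∀ i, |x i| ≤ r) (k : ℕ) =>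
    tendsto_integral_normalizedField_pow_box hβ hcorr hSigpos hLne hF k
  have hSiglim := tendsto_blockSpinVariance_box (μ := μ) hβ hcorr L
  have hlimL : Tendsto (fun M : ℕ =>
      |(∫ σ, normalizedField (isingMeasure (zdGraph d) (box d M) β 0 .free) L f σ ^ (2 * n)
            ∂(isingMeasure (zdGraph d) (box d M) β 0 .free)) -
          ((2 * n)! : ℝ) / (2 ^ n * n !) *
            (∫ σ, normalizedField (isingMeasure (zdGraph d) (box d M) β 0 .free) L f σ ^ 2
              ∂(isingMeasure (zdGraph d) (box d M) β 0 .free)) ^ n|) atTop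
      (𝓝 |(∫ σ, normalizedField μ L f σ ^ (2 * n) ∂μ) -
          ((2 * n)! : ℝ) / (2 ^ n * n !) * (∫ σ, normalizedField μ L f σ ^ 2 ∂μ) ^ n|) :=
    ((hm hfr (2 * n)).sub (((hm hfr 2).pow n).const_mul _)).abs
  have hlimR : Tendsto (fun M : ℕ => 8 * (2 * n : ℝ) ^ 4 * Mf ^ 4 *
        (Cr * D ^ 2 / blockSpinVariance (isingMeasure (zdGraph d) (box d M) β 0 .free) L ^ 2) *
        (γ * (∫ σ, normalizedField (isingMeasure (zdGraph d) (box d M) β 0 .free) L (fun x => |f x|) σ ^ 2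
          ∂(isingMeasure (zdGraph d) (box d M) β 0 .free)) ^ (n - 2))) atTop
      (𝓝 (8 * (2 * n : ℝ) ^ 4 * Mf ^ 4 * (Cr * D ^ 2 / blockSpinVariance μ L ^ 2) *
        (γ * (∫ σ, normalizedField μ L (fun x => |f x|) σ ^ 2 ∂μ) ^ (n - 2)))) :=
    ((tendsto_const_nhds.mul (tendsto_const_nhds.div (hSiglim.pow 2) (pow_ne_zero 2 hSigpos.ne'))).mul
      (((hm hfar 2).pow (n - 2)).const_mul γ))
  have hle := le_of_tendsto_of_tendsto hlimL hlimR (by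
    filter_upwards [eventually_ge_atTop ⌊r * L⌋₊] with M hM
    exact hfin M hM)
  -- Step 4: `|Λ_{m₀}| χ_{m₀} ≤ Σ_L`
  have hratio : Cr * D ^ 2 / blockSpinVariance μ L ^ 2 ≤ Cr := by
    rw [div_le_iff₀ (pow_pos hSigpos 2)]
    exact mul_le_mul_of_nonneg_left (pow_le_pow_left₀ hD0.le hden 2) hCr0
  have hm0 : 0 ≤ γ * (∫ σ, normalizedField μ L (fun x => |f x|) σ ^ 2 ∂μ) ^ (n - 2) :=
    mul_nonneg hγ0 (pow_nonneg (integral_nonneg fun σ => sq_nonneg _) _)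
  calc _ ≤ 8 * (2 * n : ℝ) ^ 4 * Mf ^ 4 * (Cr * D ^ 2 / blockSpinVariance μ L ^ 2) *
        (γ * (∫ σ, normalizedField μ L (fun x => |f x|) σ ^ 2 ∂μ) ^ (n - 2)) := hle
    _ ≤ 8 * (2 * n : ℝ) ^ 4 * Mf ^ 4 * Cr *
        (γ * (∫ σ, normalizedField μ L (fun x => |f x|) σ ^ 2 ∂μ) ^ (n - 2)) :=
        mul_le_mul_of_nonneg_right (mul_le_mul_of_nonneg_left hratio (by positivity)) hm0
    _ = (2 * n : ℝ) ^ 4 * (8 * Mf ^ 4 * Cr) *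
        (γ * (∫ σ, normalizedField μ L (fun x => |f x|) σ ^ 2 ∂μ) ^ (n - 2)) := by ring

/-! ### Step 4. Summation over `n` and the discharge -/

/-- For `0 < β ≤ β_c`: `1 ≤ (β_c² + 1)(β⁻⁴ ∨ β⁻²)` (so a `β`-uniform constant `C` is at most
`C (β_c² + 1)(β⁻⁴ ∨ β⁻²)`, the printed `β`-dependence of Panis 2023, Thm 5.5). [folklore] -/
theorem one_le_mul_max_zpow_neg {β βc : ℝ} (hβ : 0 < β) (hβc : β ≤ βc) :
    1 ≤ (βc ^ 2 + 1) * max (β ^ (-4 : ℤ)) (β ^ (-2 : ℤ)) := by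
  have h2 : β ^ (-2 : ℤ) = (β ^ 2)⁻¹ := by rw [zpow_neg, zpow_ofNat]
  have hβ2 : 0 < β ^ 2 := by positivity
  have hle : β ^ 2 ≤ βc ^ 2 + 1 := by
    have : β ^ 2 ≤ βc ^ 2 := pow_le_pow_left₀ hβ.le hβc 2
    linarith
  have hβc0 : 0 ≤ βc ^ 2 + 1 := by positivity
  calc (1 : ℝ) = β ^ 2 * (β ^ 2)⁻¹ := (mul_inv_cancel₀ hβ2.ne').symm
    _ ≤ (βc ^ 2 + 1) * (β ^ 2)⁻¹ := mul_le_mul_of_nonneg_right hle (inv_nonneg.2 hβ2.le)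
    _ ≤ (βc ^ 2 + 1) * max (β ^ (-4 : ℤ)) (β ^ (-2 : ℤ)) := by
        rw [← h2]
        exact mul_le_mul_of_nonneg_left (le_max_right _ _) hβc0

/-- **Discharge of the named fact `panis_mgf_normalizedField_bound`** (`HighDimTriviality`; R. Panis,
Ann. Probab. 54 (2026) = arXiv:2309.05797, **Theorem 5.5**, for the nearest-neighbour ferromagnetic
Ising model on `ℤ^d`, `d ≥ 5`, `η = 0`): there are `C, γ > 0` (here `γ = 4d`) such that for all
`0 < β ≤ β_c`, `L ≥ 1`, `r ≥ 1`, every `μ ∈ 𝒢(β,0)`, every continuous `f` vanishing outside `[-r,r]^d`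
and every real `z`,
`|⟨exp(z T_{f,L})⟩ - exp(z²/2 ⟨T_{f,L}²⟩)| ≤ exp(z²/2 ⟨T_{|f|,L}²⟩) C (β⁻⁴ ∨ β⁻²) ‖f‖_∞⁴ r^γ z⁴ / L^{d-4}`.
Proof: the moment bound `abs_moment_sub_wick_le_of_le_criticalBeta` (tree-form Aizenman inequality with
coincident points + infrared bounds), the vanishing of odd moments (uniqueness and flip symmetry of the
free state, `oddSpinCorrelation_eq_zero_holds`) and the summation `abs_mgf_sub_exp_le_of_wickMoment_bounds`
("Multiplying by `z^{2n}/(2n)!` and summing over `n`", Panis p. 21). [cite: Panis2023Triviality, Thm. 5.5 and its proof (pp. 21–22)] -/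
theorem panis_mgf_normalizedField_bound_holds : panis_mgf_normalizedField_bound := by
  intro d hd
  have hd3 : 3 ≤ d := by omega
  obtain ⟨C, hC, H⟩ := abs_moment_sub_wick_le_of_le_criticalBeta (d := d) hd
  refine ⟨128 * C * (criticalBeta d ^ 2 + 1), 4 * d, by positivity, by positivity, ?_⟩
  intro β L r hβ hβc hL hr μ hμ f hf hfr z
  haveI : IsProbabilityMeasure μ := hμ.1
  have hdpos : 0 < d := by omega
  have hLpos : 0 < L := by linarith
  have hLne : L ≠ 0 := hLpos.ne'
  have hr0 : 0 < r := by linarith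
  -- the odd moments vanish
  have hodd : ∀ n : ℕ, ∫ σ, normalizedField μ L f σ ^ (2 * n + 1) ∂μ = 0 := fun n =>
    integral_normalizedField_pow_eq_zero_of_odd oddSpinCorrelation_eq_zero_holds hd3 hβ.le hβc hμ hLne
      hfr ⟨n, rfl⟩
  -- the moment bound and the summation
  set E : ℝ := 8 * (⨆ x, |f x|) ^ 4 * (C * r ^ (4 * d) / L ^ (d - 4)) with hE
  have hE0 : 0 ≤ E := by
    have : 0 ≤ ⨆ x, |f x| := iSup_abs_nonneg f
    positivity
  have hW0 : 0 ≤ ∫ σ, normalizedField μ L (fun x => |f x|) σ ^ 2 ∂μ := integral_nonneg fun σ => sq_nonneg _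
  have hdev : ∀ n : ℕ, 2 ≤ n →
      |(∫ σ, normalizedField μ L f σ ^ (2 * n) ∂μ) -
          ((2 * n)! : ℝ) / (2 ^ n * n !) * (∫ σ, normalizedField μ L f σ ^ 2 ∂μ) ^ n|
        ≤ (2 * n : ℝ) ^ 4 * E * (((2 * (n - 2))! : ℝ) / (2 ^ (n - 2) * (n - 2)!) *
            (∫ σ, normalizedField μ L (fun x => |f x|) σ ^ 2 ∂μ) ^ (n - 2)) := fun n hn =>
    H β hβ.le hβc μ hμ L r hL hr f hf hfr n hn
  have key := abs_mgf_sub_exp_le_of_wickMoment_bounds (μ := μ) (X := normalizedField μ L f)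
    (measurable_normalizedField μ hLne hfr) (abs_normalizedField_le μ hLne hfr) hE0 hW0 hdev hodd z
  refine key.trans ?_
  -- constants: `16 E = 128 ‖f‖⁴ C r^{4d}/L^{d-4}` and `1 ≤ (β_c² + 1)(β⁻⁴ ∨ β⁻²)`
  have hrpow : r ^ ((4 * d : ℕ) : ℝ) = r ^ (4 * d) := Real.rpow_natCast r (4 * d)
  have hcast : ((4 : ℝ) * d) = ((4 * d : ℕ) : ℝ) := by push_cast; ring
  rw [hcast, hrpow]
  have hmax := one_le_mul_max_zpow_neg hβ hβc (βc := criticalBeta d)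
  have hexp0 : 0 ≤ Real.exp (z ^ 2 / 2 * ∫ σ, normalizedField μ L (fun x => |f x|) σ ^ 2 ∂μ) :=
    (Real.exp_pos _).le
  have hX : 0 ≤ 128 * (⨆ x, |f x|) ^ 4 * (C * r ^ (4 * d) / L ^ (d - 4)) * z ^ 4 := by
    have : 0 ≤ ⨆ x, |f x| := iSup_abs_nonneg f
    positivity
  calc 16 * E * z ^ 4 * Real.exp (z ^ 2 / 2 * ∫ σ, normalizedField μ L (fun x => |f x|) σ ^ 2 ∂μ)
      = Real.exp (z ^ 2 / 2 * ∫ σ, normalizedField μ L (fun x => |f x|) σ ^ 2 ∂μ) *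
          (1 * (128 * (⨆ x, |f x|) ^ 4 * (C * r ^ (4 * d) / L ^ (d - 4)) * z ^ 4)) := by
        rw [hE]; ring
    _ ≤ Real.exp (z ^ 2 / 2 * ∫ σ, normalizedField μ L (fun x => |f x|) σ ^ 2 ∂μ) *
          (((criticalBeta d ^ 2 + 1) * max (β ^ (-4 : ℤ)) (β ^ (-2 : ℤ))) *
            (128 * (⨆ x, |f x|) ^ 4 * (C * r ^ (4 * d) / L ^ (d - 4)) * z ^ 4)) :=
        mul_le_mul_of_nonneg_left (mul_le_mul_of_nonneg_right hmax hX) hexp0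
    _ = Real.exp (z ^ 2 / 2 * ∫ σ, normalizedField μ L (fun x => |f x|) σ ^ 2 ∂μ) *
          (128 * C * (criticalBeta d ^ 2 + 1) * max (β ^ (-4 : ℤ)) (β ^ (-2 : ℤ)) * (⨆ x, |f x|) ^ 4 *
            r ^ (4 * d) * z ^ 4 / L ^ (d - 4)) := by ring

end Literature.Probability.LatticeModels
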